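import Mathlib
import Literature.NumberTheory.Transcendental.GammaFields
import Summits.Schanuel.Schanuel.Theorems.RigidCoreAclSubsetLogFreeCoreCaseIIMonomials

/-!
# Case II core, file 6a: Laurent-monomial coordinates — the ring `R = k[exp Y'']`
(helper file for the registered stub `stub_caseII_core` of line `eac-extends-core-automorphisms`,
crux stmt-Schanuel-0968 `Summit.Schanuel.Schanuel.Theses.RigidCore.AclSubsetLogFreeCore`)

Same setting as file 4.  For a basis `b` of `Y''` modulo `Y'` and `N ≥ 1` write
`t i = exp ((1/N) • b i)` (algebraically independent over `k`) and `ev_N = MvPolynomial.aeval t`.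

* `aeval_eq_sum_exp` — `ev_N P` is the exponential sum `Σ_{α ∈ supp P} P.coeff α * exp y_α` with
  `y_α = Σ (α i / N) • b i ∈ Y''`, exponents pairwise inequivalent modulo `Y'`.
* "Laurent polynomials": elements `x` with `x * ev_N (X^M) = ev_N F` for some level `N`.  They contain
  `k` and `exp (Y'')`, are closed under sums and products (`exists_laurent_add/mul/sum`), and are
  preserved by exponential automorphisms stabilising `k` and `Y''` (`exists_laurent_map`).
* The field `K = k(exp Y'')` is treated in the sequel file `…CaseIIFractions`.
-/

noncomputable section

set_option linter.dupNamespace false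

open Set
open scoped BigOperators
open Literature.ModelTheory.ExponentialFields Literature.ModelTheory.ExponentialFields.ExponentialRing
open Literature.NumberTheory.Transcendental Literature.NumberTheory.Transcendental.GammaField

namespace Summit.Schanuel.Schanuel.Theorems.RigidCore

namespace CaseIICore

variable {E : Type*} [Field E] [CharZero E] [ExponentialRing E]

/-! ### Evaluating polynomials at the level-`N` coordinates -/

/-- The value of a monomial at the level-`N` coordinates is a constant times an exponential:
`ev_N (c X^α) = c * exp (Σ (α i / N) • b i)`. [folklore] -/
theorem aeval_monomial_exp (k : Subfield E) {p : ℕ} (b : Fin p → E) (N : ℕ)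
    (α : Fin p →₀ ℕ) (c : k) :
    MvPolynomial.aeval (fun i => exp ((1 / (N : ℚ)) • b i)) (MvPolynomial.monomial α c) =
      (c : E) * exp (∑ i, (((α i : ℕ) : ℚ) / N) • b i) := by
  rw [MvPolynomial.aeval_monomial, Finsupp.prod_fintype _ _ (fun i => pow_zero _),
    show (algebraMap k E) c = (c : E) from rfl]
  congr 1
  have h := exp_coords b N (fun i => ((α i : ℕ) : ℤ)) 0
  simp only [Int.cast_natCast, zpow_natCast, zero_add, exp_zero, one_mul] at h
  exact h.symm

/-- `ev_N (X^α)` is the exponential of an element of `Y''`. [folklore] -/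
theorem aeval_monomial_one_eq_exp (k : Subfield E) {Y'' : Submodule ℚ E} {p : ℕ} (b : Fin p → E)
    (hbY : ∀ i, b i ∈ Y'') (N : ℕ) (α : Fin p →₀ ℕ) :
    ∃ y ∈ Y'', MvPolynomial.aeval (fun i => exp ((1 / (N : ℚ)) • b i))
      (MvPolynomial.monomial α (1 : k)) = exp y := by
  refine ⟨∑ i, (((α i : ℕ) : ℚ) / N) • b i, Y''.sum_mem fun i _ => Y''.smul_mem _ (hbY i), ?_⟩
  rw [aeval_monomial_exp, OneMemClass.coe_one, one_mul]

/-- `ev_N (X^α) ≠ 0`. [folklore] -/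
theorem aeval_monomial_one_ne_zero (k : Subfield E) {p : ℕ} (b : Fin p → E) (N : ℕ) (α : Fin p →₀ ℕ) :
    MvPolynomial.aeval (fun i => exp ((1 / (N : ℚ)) • b i)) (MvPolynomial.monomial α (1 : k)) ≠ 0 := by
  rw [aeval_monomial_exp, OneMemClass.coe_one, one_mul]
  exact exp_ne_zero _

/-- `ev_N (X^0) = 1`. [folklore] -/
theorem aeval_monomial_zero_one (k : Subfield E) {p : ℕ} (b : Fin p → E) (N : ℕ) :
    MvPolynomial.aeval (fun i => exp ((1 / (N : ℚ)) • b i)) (MvPolynomial.monomial 0 (1 : k)) = 1 := by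
  rw [MvPolynomial.aeval_monomial, map_one, one_mul, Finsupp.prod_zero_index]

open Classical in
/-- **`ev_N P` as an exponential sum** over the support of `P`, with exponents
`y_α = Σ (α i / N) • b i`. [folklore] -/
theorem aeval_eq_sum_exp (k : Subfield E) {p : ℕ} (b : Fin p → E) (N : ℕ)
    (P : MvPolynomial (Fin p) k) :
    MvPolynomial.aeval (fun i => exp ((1 / (N : ℚ)) • b i)) P =
      ∑ α ∈ P.support, ((P.coeff α : k) : E) * exp (∑ i, (((α i : ℕ) : ℚ) / N) • b i) := by
  conv_lhs => rw [P.as_sum, map_sum]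
  exact Finset.sum_congr rfl fun α _ => aeval_monomial_exp k b N α (P.coeff α)

omit [ExponentialRing E] in
/-- The exponents `y_α` lie in `Y''`. [folklore] -/
theorem expnt_mem {Y'' : Submodule ℚ E} {p : ℕ} (b : Fin p → E) (hbY : ∀ i, b i ∈ Y'') (N : ℕ)
    (α : Fin p →₀ ℕ) : (∑ i, (((α i : ℕ) : ℚ) / N) • b i) ∈ Y'' :=
  Y''.sum_mem fun i _ => Y''.smul_mem _ (hbY i)

omit [ExponentialRing E] in
/-- The exponents `y_α` are pairwise inequivalent modulo `Y'` (for `b` independent modulo `Y'`).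
[folklore] -/
theorem expnt_sub_expnt_not_mem {Y' : Submodule ℚ E} {p : ℕ} (b : Fin p → E)
    (hblin : ∀ r : Fin p → ℚ, (∑ i, r i • b i) ∈ Y' → r = 0) {N : ℕ} (hN : 0 < N)
    {α β : Fin p →₀ ℕ} (hne : α ≠ β) :
    (∑ i, (((α i : ℕ) : ℚ) / N) • b i) - (∑ i, (((β i : ℕ) : ℚ) / N) • b i) ∉ Y' := by
  intro h
  apply hne
  have h' := (coords_eq_iff b hblin hN (n := fun i => ((α i : ℕ) : ℤ)) (n' := fun i => ((β i : ℕ) : ℤ))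
    Y'.zero_mem Y'.zero_mem).1 (by simpa only [zero_add, Int.cast_natCast] using h)
  ext i
  have := congrFun h' i
  exact_mod_cast this

/-- **Injectivity of `ev_N`** (algebraic independence of the level-`N` coordinates). [folklore] -/
theorem aeval_injective (k : Subfield E) {p : ℕ} (b : Fin p → E)
    (hAI : ∀ N : ℕ, 0 < N → AlgebraicIndependent k (fun i => exp ((1 / (N : ℚ)) • b i)))
    {N : ℕ} (hN : 0 < N) {F G : MvPolynomial (Fin p) k}
    (h : MvPolynomial.aeval (fun i => exp ((1 / (N : ℚ)) • b i)) F =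
      MvPolynomial.aeval (fun i => exp ((1 / (N : ℚ)) • b i)) G) : F = G :=
  (algebraicIndependent_iff_injective_aeval.1 (hAI N hN)) h

/-! ### Change of level -/

/-- Refinement of the level: `ev_{Ne} (expand e F) = ev_N F`. [folklore] -/
theorem aeval_expand (k : Subfield E) {p : ℕ} (b : Fin p → E) {N : ℕ} (hN : 0 < N) {e : ℕ} (he : 0 < e)
    (F : MvPolynomial (Fin p) k) :
    MvPolynomial.aeval (fun i => exp ((1 / ((N * e : ℕ) : ℚ)) • b i)) (MvPolynomial.expand e F) =
      MvPolynomial.aeval (fun i => exp ((1 / (N : ℚ)) • b i)) F := by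
  have ht : (fun i => MvPolynomial.aeval (fun i => exp ((1 / ((N * e : ℕ) : ℚ)) • b i))
      (MvPolynomial.X i ^ e : MvPolynomial (Fin p) k)) = fun i => exp ((1 / (N : ℚ)) • b i) := by
    funext i
    rw [map_pow, MvPolynomial.aeval_X, ← exp_nsmul, ← Nat.cast_smul_eq_nsmul ℚ, smul_smul]
    congr 1
    have hN0 : (N : ℚ) ≠ 0 := by exact_mod_cast hN.ne'
    have he0 : (e : ℚ) ≠ 0 := by exact_mod_cast he.ne'
    rw [Nat.cast_mul]
    field_simp
  rw [MvPolynomial.expand, MvPolynomial.aeval_bind₁, ht]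

/-- A fraction `z * ev_N Q = ev_N P` persists at level `N e` with `expand e`. [folklore] -/
theorem fraction_level (k : Subfield E) {p : ℕ} (b : Fin p → E) {N : ℕ} (hN : 0 < N) {e : ℕ} (he : 0 < e)
    {z : E} {P Q : MvPolynomial (Fin p) k}
    (h : z * MvPolynomial.aeval (fun i => exp ((1 / (N : ℚ)) • b i)) Q =
      MvPolynomial.aeval (fun i => exp ((1 / (N : ℚ)) • b i)) P) :
    z * MvPolynomial.aeval (fun i => exp ((1 / ((N * e : ℕ) : ℚ)) • b i)) (MvPolynomial.expand e Q) =
      MvPolynomial.aeval (fun i => exp ((1 / ((N * e : ℕ) : ℚ)) • b i)) (MvPolynomial.expand e P) := by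
  rw [aeval_expand k b hN he, aeval_expand k b hN he, h]

/-- A Laurent presentation `x * ev_N (X^M) = ev_N F` persists at level `N e`. [folklore] -/
theorem laurent_level (k : Subfield E) {p : ℕ} (b : Fin p → E) {N : ℕ} (hN : 0 < N) {e : ℕ} (he : 0 < e)
    {x : E} {F : MvPolynomial (Fin p) k} {M : Fin p →₀ ℕ}
    (h : x * MvPolynomial.aeval (fun i => exp ((1 / (N : ℚ)) • b i)) (MvPolynomial.monomial M (1 : k)) =
      MvPolynomial.aeval (fun i => exp ((1 / (N : ℚ)) • b i)) F) :
    x * MvPolynomial.aeval (fun i => exp ((1 / ((N * e : ℕ) : ℚ)) • b i))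
        (MvPolynomial.monomial (e • M) (1 : k)) =
      MvPolynomial.aeval (fun i => exp ((1 / ((N * e : ℕ) : ℚ)) • b i)) (MvPolynomial.expand e F) := by
  rw [← MvPolynomial.expand_monomial, aeval_expand k b hN he, aeval_expand k b hN he, h]

/-! ### Laurent polynomials: closure properties -/

/-- Sum of two Laurent presentations at the same level. [folklore] -/
theorem laurent_add_same (k : Subfield E) {p : ℕ} (b : Fin p → E) (N : ℕ)
    {x₁ x₂ : E} {F₁ F₂ : MvPolynomial (Fin p) k} {M₁ M₂ : Fin p →₀ ℕ}
    (h₁ : x₁ * MvPolynomial.aeval (fun i => exp ((1 / (N : ℚ)) • b i)) (MvPolynomial.monomial M₁ (1 : k)) =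
      MvPolynomial.aeval (fun i => exp ((1 / (N : ℚ)) • b i)) F₁)
    (h₂ : x₂ * MvPolynomial.aeval (fun i => exp ((1 / (N : ℚ)) • b i)) (MvPolynomial.monomial M₂ (1 : k)) =
      MvPolynomial.aeval (fun i => exp ((1 / (N : ℚ)) • b i)) F₂) :
    (x₁ + x₂) * MvPolynomial.aeval (fun i => exp ((1 / (N : ℚ)) • b i))
        (MvPolynomial.monomial (M₁ + M₂) (1 : k)) =
      MvPolynomial.aeval (fun i => exp ((1 / (N : ℚ)) • b i))
        (F₁ * MvPolynomial.monomial M₂ 1 + F₂ * MvPolynomial.monomial M₁ 1) := by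
  have hm : MvPolynomial.monomial (M₁ + M₂) (1 : k) =
      MvPolynomial.monomial M₁ 1 * MvPolynomial.monomial M₂ 1 := by
    rw [MvPolynomial.monomial_mul, one_mul]
  rw [hm, map_add, map_mul, map_mul, map_mul, ← h₁, ← h₂]
  ring

/-- Product of two Laurent presentations at the same level. [folklore] -/
theorem laurent_mul_same (k : Subfield E) {p : ℕ} (b : Fin p → E) (N : ℕ)
    {x₁ x₂ : E} {F₁ F₂ : MvPolynomial (Fin p) k} {M₁ M₂ : Fin p →₀ ℕ}
    (h₁ : x₁ * MvPolynomial.aeval (fun i => exp ((1 / (N : ℚ)) • b i)) (MvPolynomial.monomial M₁ (1 : k)) =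
      MvPolynomial.aeval (fun i => exp ((1 / (N : ℚ)) • b i)) F₁)
    (h₂ : x₂ * MvPolynomial.aeval (fun i => exp ((1 / (N : ℚ)) • b i)) (MvPolynomial.monomial M₂ (1 : k)) =
      MvPolynomial.aeval (fun i => exp ((1 / (N : ℚ)) • b i)) F₂) :
    (x₁ * x₂) * MvPolynomial.aeval (fun i => exp ((1 / (N : ℚ)) • b i))
        (MvPolynomial.monomial (M₁ + M₂) (1 : k)) =
      MvPolynomial.aeval (fun i => exp ((1 / (N : ℚ)) • b i)) (F₁ * F₂) := by
  have hm : MvPolynomial.monomial (M₁ + M₂) (1 : k) =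
      MvPolynomial.monomial M₁ 1 * MvPolynomial.monomial M₂ 1 := by
    rw [MvPolynomial.monomial_mul, one_mul]
  rw [hm, map_mul, map_mul, ← h₁, ← h₂]
  ring

/-- `0` is a Laurent polynomial. [folklore] -/
theorem exists_laurent_zero (k : Subfield E) {p : ℕ} (b : Fin p → E) :
    ∃ N : ℕ, 0 < N ∧ ∃ (F : MvPolynomial (Fin p) k) (M : Fin p →₀ ℕ),
      (0 : E) * MvPolynomial.aeval (fun i => exp ((1 / (N : ℚ)) • b i)) (MvPolynomial.monomial M (1 : k)) =
        MvPolynomial.aeval (fun i => exp ((1 / (N : ℚ)) • b i)) F :=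
  ⟨1, one_pos, 0, 0, by rw [zero_mul, map_zero]⟩

/-- Constants of `k` are Laurent polynomials. [folklore] -/
theorem exists_laurent_const (k : Subfield E) {p : ℕ} (b : Fin p → E) {c : E} (hc : c ∈ k) :
    ∃ N : ℕ, 0 < N ∧ ∃ (F : MvPolynomial (Fin p) k) (M : Fin p →₀ ℕ),
      c * MvPolynomial.aeval (fun i => exp ((1 / (N : ℚ)) • b i)) (MvPolynomial.monomial M (1 : k)) =
        MvPolynomial.aeval (fun i => exp ((1 / (N : ℚ)) • b i)) F :=
  ⟨1, one_pos, MvPolynomial.C ⟨c, hc⟩, 0, by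
    rw [aeval_monomial_zero_one, mul_one, MvPolynomial.aeval_C]; rfl⟩

/-- Sums of Laurent polynomials are Laurent polynomials. [folklore] -/
theorem exists_laurent_add (k : Subfield E) {p : ℕ} (b : Fin p → E) {x₁ x₂ : E}
    (h₁ : ∃ N : ℕ, 0 < N ∧ ∃ (F : MvPolynomial (Fin p) k) (M : Fin p →₀ ℕ),
      x₁ * MvPolynomial.aeval (fun i => exp ((1 / (N : ℚ)) • b i)) (MvPolynomial.monomial M (1 : k)) =
        MvPolynomial.aeval (fun i => exp ((1 / (N : ℚ)) • b i)) F)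
    (h₂ : ∃ N : ℕ, 0 < N ∧ ∃ (F : MvPolynomial (Fin p) k) (M : Fin p →₀ ℕ),
      x₂ * MvPolynomial.aeval (fun i => exp ((1 / (N : ℚ)) • b i)) (MvPolynomial.monomial M (1 : k)) =
        MvPolynomial.aeval (fun i => exp ((1 / (N : ℚ)) • b i)) F) :
    ∃ N : ℕ, 0 < N ∧ ∃ (F : MvPolynomial (Fin p) k) (M : Fin p →₀ ℕ),
      (x₁ + x₂) * MvPolynomial.aeval (fun i => exp ((1 / (N : ℚ)) • b i)) (MvPolynomial.monomial M (1 : k)) =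
        MvPolynomial.aeval (fun i => exp ((1 / (N : ℚ)) • b i)) F := by
  obtain ⟨N₁, hN₁, F₁, M₁, h₁⟩ := h₁
  obtain ⟨N₂, hN₂, F₂, M₂, h₂⟩ := h₂
  have h₁' := laurent_level k b hN₁ hN₂ h₁
  have h₂' := laurent_level k b hN₂ hN₁ h₂
  rw [Nat.mul_comm N₂ N₁] at h₂'
  exact ⟨N₁ * N₂, Nat.mul_pos hN₁ hN₂, _, _, laurent_add_same k b (N₁ * N₂) h₁' h₂'⟩

/-- Products of Laurent polynomials are Laurent polynomials. [folklore] -/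
theorem exists_laurent_mul (k : Subfield E) {p : ℕ} (b : Fin p → E) {x₁ x₂ : E}
    (h₁ : ∃ N : ℕ, 0 < N ∧ ∃ (F : MvPolynomial (Fin p) k) (M : Fin p →₀ ℕ),
      x₁ * MvPolynomial.aeval (fun i => exp ((1 / (N : ℚ)) • b i)) (MvPolynomial.monomial M (1 : k)) =
        MvPolynomial.aeval (fun i => exp ((1 / (N : ℚ)) • b i)) F)
    (h₂ : ∃ N : ℕ, 0 < N ∧ ∃ (F : MvPolynomial (Fin p) k) (M : Fin p →₀ ℕ),
      x₂ * MvPolynomial.aeval (fun i => exp ((1 / (N : ℚ)) • b i)) (MvPolynomial.monomial M (1 : k)) =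
        MvPolynomial.aeval (fun i => exp ((1 / (N : ℚ)) • b i)) F) :
    ∃ N : ℕ, 0 < N ∧ ∃ (F : MvPolynomial (Fin p) k) (M : Fin p →₀ ℕ),
      (x₁ * x₂) * MvPolynomial.aeval (fun i => exp ((1 / (N : ℚ)) • b i)) (MvPolynomial.monomial M (1 : k)) =
        MvPolynomial.aeval (fun i => exp ((1 / (N : ℚ)) • b i)) F := by
  obtain ⟨N₁, hN₁, F₁, M₁, h₁⟩ := h₁
  obtain ⟨N₂, hN₂, F₂, M₂, h₂⟩ := h₂
  have h₁' := laurent_level k b hN₁ hN₂ h₁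
  have h₂' := laurent_level k b hN₂ hN₁ h₂
  rw [Nat.mul_comm N₂ N₁] at h₂'
  exact ⟨N₁ * N₂, Nat.mul_pos hN₁ hN₂, _, _, laurent_mul_same k b (N₁ * N₂) h₁' h₂'⟩

/-- Finite sums of Laurent polynomials are Laurent polynomials. [folklore] -/
theorem exists_laurent_sum (k : Subfield E) {p : ℕ} (b : Fin p → E) {ι : Type*} (s : Finset ι) (f : ι → E)
    (h : ∀ j ∈ s, ∃ N : ℕ, 0 < N ∧ ∃ (F : MvPolynomial (Fin p) k) (M : Fin p →₀ ℕ),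
      f j * MvPolynomial.aeval (fun i => exp ((1 / (N : ℚ)) • b i)) (MvPolynomial.monomial M (1 : k)) =
        MvPolynomial.aeval (fun i => exp ((1 / (N : ℚ)) • b i)) F) :
    ∃ N : ℕ, 0 < N ∧ ∃ (F : MvPolynomial (Fin p) k) (M : Fin p →₀ ℕ),
      (∑ j ∈ s, f j) * MvPolynomial.aeval (fun i => exp ((1 / (N : ℚ)) • b i)) (MvPolynomial.monomial M (1 : k)) =
        MvPolynomial.aeval (fun i => exp ((1 / (N : ℚ)) • b i)) F :=
  Finset.sum_induction f (fun x => ∃ N : ℕ, 0 < N ∧ ∃ (F : MvPolynomial (Fin p) k) (M : Fin p →₀ ℕ),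
      x * MvPolynomial.aeval (fun i => exp ((1 / (N : ℚ)) • b i)) (MvPolynomial.monomial M (1 : k)) =
        MvPolynomial.aeval (fun i => exp ((1 / (N : ℚ)) • b i)) F)
    (fun _ _ ha hb => exists_laurent_add k b ha hb) (exists_laurent_zero k b) h

/-- **Exponentials of `Y''` are Laurent monomials**: `exp y * ev_N (X^{M⁻}) = ev_N (c X^{M⁺})` with
`c = exp y' ∈ kˣ`. [folklore] -/
theorem exists_laurent_exp (k : Subfield E) {Y' Y'' : Submodule ℚ E} {p : ℕ} (b : Fin p → E)
    (hbspan : ∀ y ∈ Y'', ∃ r : Fin p → ℚ, y - ∑ i, r i • b i ∈ Y')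
    (hexpY' : ∀ y ∈ Y', exp y ∈ k) {y : E} (hy : y ∈ Y'') :
    ∃ N : ℕ, 0 < N ∧ ∃ (Mp Mm : Fin p →₀ ℕ) (c : k), (c : E) ≠ 0 ∧
      exp y * MvPolynomial.aeval (fun i => exp ((1 / (N : ℚ)) • b i)) (MvPolynomial.monomial Mm (1 : k)) =
        MvPolynomial.aeval (fun i => exp ((1 / (N : ℚ)) • b i)) (MvPolynomial.monomial Mp c) := by
  obtain ⟨N, hN, n, y', hy', rfl⟩ := exists_coords b hbspan hy
  refine ⟨N, hN, Finsupp.equivFunOnFinite.symm (fun i => (n i).toNat),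
    Finsupp.equivFunOnFinite.symm (fun i => (-n i).toNat), ⟨exp y', hexpY' y' hy'⟩, exp_ne_zero _, ?_⟩
  rw [exp_coords, MvPolynomial.aeval_monomial, MvPolynomial.aeval_monomial,
    Finsupp.prod_fintype _ _ (fun i => pow_zero _), Finsupp.prod_fintype _ _ (fun i => pow_zero _),
    map_one, one_mul, show (algebraMap k E) ⟨exp y', hexpY' y' hy'⟩ = exp y' from rfl, mul_assoc,
    ← Finset.prod_mul_distrib]
  congr 1
  refine Finset.prod_congr rfl fun i _ => ?_
  simp only [Finsupp.coe_equivFunOnFinite_symm]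
  rw [← zpow_natCast, ← zpow_natCast, ← zpow_add₀ (exp_ne_zero _)]
  congr 1
  have := Int.toNat_sub_toNat_neg (n i)
  omega

/-- `c * exp y` (`c ∈ k`, `y ∈ Y''`) is a Laurent polynomial. [folklore] -/
theorem exists_laurent_const_mul_exp (k : Subfield E) {Y' Y'' : Submodule ℚ E} {p : ℕ} (b : Fin p → E)
    (hbspan : ∀ y ∈ Y'', ∃ r : Fin p → ℚ, y - ∑ i, r i • b i ∈ Y')
    (hexpY' : ∀ y ∈ Y', exp y ∈ k) {c y : E} (hc : c ∈ k) (hy : y ∈ Y'') :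
    ∃ N : ℕ, 0 < N ∧ ∃ (F : MvPolynomial (Fin p) k) (M : Fin p →₀ ℕ),
      (c * exp y) * MvPolynomial.aeval (fun i => exp ((1 / (N : ℚ)) • b i)) (MvPolynomial.monomial M (1 : k)) =
        MvPolynomial.aeval (fun i => exp ((1 / (N : ℚ)) • b i)) F := by
  obtain ⟨N, hN, Mp, Mm, c₁, -, h⟩ := exists_laurent_exp k b hbspan hexpY' hy
  refine ⟨N, hN, MvPolynomial.C ⟨c, hc⟩ * MvPolynomial.monomial Mp c₁, Mm, ?_⟩
  rw [map_mul, MvPolynomial.aeval_C, ← h, show (algebraMap k E) ⟨c, hc⟩ = c from rfl, mul_assoc]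

/-- Values `ev_N F` are Laurent polynomials (trivially). [folklore] -/
theorem exists_laurent_aeval (k : Subfield E) {p : ℕ} (b : Fin p → E) {N : ℕ} (hN : 0 < N)
    (F : MvPolynomial (Fin p) k) :
    ∃ N' : ℕ, 0 < N' ∧ ∃ (F' : MvPolynomial (Fin p) k) (M : Fin p →₀ ℕ),
      MvPolynomial.aeval (fun i => exp ((1 / (N : ℚ)) • b i)) F *
          MvPolynomial.aeval (fun i => exp ((1 / (N' : ℚ)) • b i)) (MvPolynomial.monomial M (1 : k)) =
        MvPolynomial.aeval (fun i => exp ((1 / (N' : ℚ)) • b i)) F' :=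
  ⟨N, hN, F, 0, by rw [aeval_monomial_zero_one, mul_one]⟩

/-- **Exponential automorphisms preserve Laurent polynomials.**  If `θ` is a ring automorphism with
`θ ∘ exp = exp ∘ θ` mapping `k` into `k` and `Y''` into `Y''`, the image of a Laurent polynomial is a
Laurent polynomial (in the SAME coordinates `b`). [folklore] -/
theorem exists_laurent_map (k : Subfield E) {Y' Y'' : Submodule ℚ E} {p : ℕ} (b : Fin p → E)
    (hbspan : ∀ y ∈ Y'', ∃ r : Fin p → ℚ, y - ∑ i, r i • b i ∈ Y')
    (hbY : ∀ i, b i ∈ Y'') (hexpY' : ∀ y ∈ Y', exp y ∈ k)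
    (θ : E ≃+* E) (hθexp : ∀ x, θ (exp x) = exp (θ x))
    (hθk : ∀ z ∈ k, θ z ∈ k) (hθY'' : ∀ y ∈ Y'', θ y ∈ Y'') {x : E}
    (h : ∃ N : ℕ, 0 < N ∧ ∃ (F : MvPolynomial (Fin p) k) (M : Fin p →₀ ℕ),
      x * MvPolynomial.aeval (fun i => exp ((1 / (N : ℚ)) • b i)) (MvPolynomial.monomial M (1 : k)) =
        MvPolynomial.aeval (fun i => exp ((1 / (N : ℚ)) • b i)) F) :
    ∃ N : ℕ, 0 < N ∧ ∃ (F : MvPolynomial (Fin p) k) (M : Fin p →₀ ℕ),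
      θ x * MvPolynomial.aeval (fun i => exp ((1 / (N : ℚ)) • b i)) (MvPolynomial.monomial M (1 : k)) =
        MvPolynomial.aeval (fun i => exp ((1 / (N : ℚ)) • b i)) F := by
  classical
  obtain ⟨N, hN, F, M, hx⟩ := h
  obtain ⟨yM, hyM, hm⟩ := aeval_monomial_one_eq_exp k b hbY N M
  rw [hm] at hx
  -- `θ (ev_N F)` is a Laurent polynomial
  have hθF : ∃ N' : ℕ, 0 < N' ∧ ∃ (F' : MvPolynomial (Fin p) k) (M' : Fin p →₀ ℕ),
      θ (MvPolynomial.aeval (fun i => exp ((1 / (N : ℚ)) • b i)) F) *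
          MvPolynomial.aeval (fun i => exp ((1 / (N' : ℚ)) • b i)) (MvPolynomial.monomial M' (1 : k)) =
        MvPolynomial.aeval (fun i => exp ((1 / (N' : ℚ)) • b i)) F' := by
    rw [aeval_eq_sum_exp k b N F, map_sum]
    refine exists_laurent_sum k b _ _ fun α _ => ?_
    rw [map_mul, hθexp]
    exact exists_laurent_const_mul_exp k b hbspan hexpY' (hθk _ (F.coeff α).2)
      (hθY'' _ (expnt_mem b hbY N α))
  -- `θ x = θ (ev_N F) * exp (-θ yM)`
  have hθx : θ x = θ (MvPolynomial.aeval (fun i => exp ((1 / (N : ℚ)) • b i)) F) * exp (-θ yM) := by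
    rw [← hx, map_mul, hθexp, mul_assoc, ← exp_add, add_neg_cancel, exp_zero, mul_one]
  rw [hθx]
  refine exists_laurent_mul k b hθF ?_
  have := exists_laurent_const_mul_exp k b hbspan hexpY' k.one_mem (Y''.neg_mem (hθY'' _ hyM))
  simpa only [one_mul] using this

end CaseIICore

/-! ### Registered helper (crux stub list of stmt-Schanuel-0968) -/

/-- **Registered form of `CaseIICore.exists_laurent_map`** (all binders explicit): exponential
automorphisms stabilising `k` and `Y''` preserve Laurent polynomials in the coordinates `b`.
[folklore] -/
theorem caseII_exists_laurent_map {E : Type*} [Field E] [CharZero E] [ExponentialRing E]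
    (k : Subfield E) {Y' Y'' : Submodule ℚ E} {p : ℕ} (b : Fin p → E)
    (hbspan : ∀ y ∈ Y'', ∃ r : Fin p → ℚ, y - ∑ i, r i • b i ∈ Y')
    (hbY : ∀ i, b i ∈ Y'') (hexpY' : ∀ y ∈ Y', exp y ∈ k)
    (θ : E ≃+* E) (hθexp : ∀ x, θ (exp x) = exp (θ x))
    (hθk : ∀ z ∈ k, θ z ∈ k) (hθY'' : ∀ y ∈ Y'', θ y ∈ Y'') {x : E}
    (h : ∃ N : ℕ, 0 < N ∧ ∃ (F : MvPolynomial (Fin p) k) (M : Fin p →₀ ℕ),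
      x * MvPolynomial.aeval (fun i => exp ((1 / (N : ℚ)) • b i)) (MvPolynomial.monomial M (1 : k)) =
        MvPolynomial.aeval (fun i => exp ((1 / (N : ℚ)) • b i)) F) :
    ∃ N : ℕ, 0 < N ∧ ∃ (F : MvPolynomial (Fin p) k) (M : Fin p →₀ ℕ),
      θ x * MvPolynomial.aeval (fun i => exp ((1 / (N : ℚ)) • b i)) (MvPolynomial.monomial M (1 : k)) =
        MvPolynomial.aeval (fun i => exp ((1 / (N : ℚ)) • b i)) F :=
  CaseIICore.exists_laurent_map k b hbspan hbY hexpY' θ hθexp hθk hθY'' h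

end Summit.Schanuel.Schanuel.Theorems.RigidCore
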